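import Literature.Probability.RandomPlanarGeometry.LoewnerLoopMassIdentity
import Literature.Probability.RandomPlanarGeometry.SLEBubblesThm65Kappa
import HarnessLib

/-!
# The loop-mass identity along the SLE_κ flow: `Λ(γ[0,∞), A; ℍ) = 2 ∫₀^∞ m(A_t − W_t) dt` a.s. on `{γ ∩ A = ∅}`

G. F. Lawler, *Partition functions, loop measure, and versions of SLE*, J. Stat. Phys. **134**
(2009) (**[Lawler2009]**), §2.2: "If `K₁ = γ_t` is a curve in `D` with `γ(0+) = 0`, with
corresponding conformal maps `g_t` …, then `Λ(γ_t, ℍ ∖ D; ℍ) = −(a/6) ∫₀ᵗ SΦ_s(U_s) ds` … If we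
had chosen the parametrization as in (1), the `a` would be replaced with `2`." This is the bridge
between the loop-measure form of the restriction martingale (`Ψ_{t,D}(γ)^{c/2}`, eq. (4),
`SLELoopRestriction`) and its Schwarzian form ([LSW] Prop. 5.3 / Thm. 6.5, the tree's
`thm65_printed`).

For the SLE_κ trace `γ = sleTrace κ ω`, `0 < κ ≤ 4` (simple, generating the chain), and `A ∈ 𝒬*`,
this file PROVES the almost-sure identity on `{γ[0,∞) ∩ A = ∅}`,

  `Λ(γ[0,∞), A; ℍ) = 2 ∫₀^∞ starBubbleMass (A_t − W_t) dt`   (`ae_loopMass_range_sleTrace_eq`),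

from the deterministic identity up to alive times (`loopMass_hull_drvK_eq_lintegral`,
`LoewnerLoopMassIdentity`) — hence from its analytic inputs, taken as hypotheses: the conformal
invariance of `Λ` (`hX : loopMass_conformalImage`, Lawler–Werner 2004 Prop. 6) and Lawler (2005)
Prop. 5.30 on Loewner hulls (`h530a`, `h530b`) — by continuity from below of the loop measure
along the hulls `K_t = γ(0, t]` exhausting `γ(0, ∞)` (`Loewner.IsGeneratedByCurve.loopMass_range_eq_iSup`)
and the conversion of the compensator to the time integral (`lintegral_timeMeasure_eq_iSup_LpK`).
No definition and no named fact is introduced.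

## References

* [Lawler2009] §2.2 (display before (4)).
* G. F. Lawler, *Conformally Invariant Processes in the Plane* (2005), Prop. 5.30, Prop. 5.34. [Lawler2005]
* G. F. Lawler, W. Werner, PTRF 128 (2004), Prop. 6, Thm. 12. [LawlerWerner2004]
* [LSW] JAMS 16 (2003), §5, Thm. 6.5. [LawlerSchrammWerner2003Restriction]
-/

noncomputable section

open Set Filter Topology MeasureTheory Metric
open UpperHalfPlane (upperHalfPlaneSet isOpen_upperHalfPlaneSet)
open Literature.Probability.Process (preWienerMeasure)
open scoped NNReal ENNReal

namespace Literature.Probability.RandomPlanarGeometry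

open Loewner UnbasedLoop

/-! ### Loops hitting the range of a simple trace: continuity from below along the hulls -/

/-- For a simple generating curve, the part of `γ[0,∞)` in `ℍ` is exhausted by the hulls
`K_t = γ(0, t]`. [folklore] -/
theorem Loewner.IsGeneratedByCurve.range_inter_eq_iUnion_hull {W : ℝ≥0 → ℝ} {γ : ℝ≥0 → ℂ}
    (hγ : IsGeneratedByCurve W γ) (hs : IsSimpleTrace γ) :
    range γ ∩ upperHalfPlaneSet = ⋃ t : ℝ≥0, hull W t := by
  ext z
  simp only [mem_inter_iff, mem_range, mem_iUnion, hγ.hull_eq_image hs, mem_image, mem_Ioc]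
  constructor
  · rintro ⟨⟨t, rfl⟩, hz⟩
    have ht : 0 < t := by
      rcases (zero_le (a := t)).eq_or_lt with h | h
      · exfalso
        have h0 : (γ t).im = 0 := by rw [← h, hγ.apply_zero, Complex.ofReal_im]
        exact absurd h0 (ne_of_gt hz)
      · exact h
    exact ⟨t, t, ⟨ht, le_rfl⟩, rfl⟩
  · rintro ⟨t, s, ⟨hs0, -⟩, rfl⟩
    exact ⟨⟨s, rfl⟩, hs.2 s hs0⟩

/-- Loops hit an increasing union iff they hit one of the sets. [folklore] -/
theorem UnbasedLoop.hit_iUnion {ι : Type*} (K : ι → Set ℂ) : hit (⋃ i, K i) = ⋃ i, hit (K i) := by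
  ext u
  simp only [mem_hit, mem_iUnion, inter_iUnion, nonempty_iUnion]

/-- **Continuity from below along the hulls**: for a simple generating curve `γ` of the chain
driven by `W` and any `A`, `Λ(γ[0,∞), A; ℍ) = sup_t Λ(A, K_t; ℍ)` (the loops of `ℍ` hitting
`γ[0,∞)` hit `γ(0,∞) = ⋃_t K_t`, an increasing union). [folklore] -/
theorem Loewner.IsGeneratedByCurve.loopMass_range_eq_iSup {W : ℝ≥0 → ℝ} {γ : ℝ≥0 → ℂ}
    (hγ : IsGeneratedByCurve W γ) (hs : IsSimpleTrace γ) (A : Set ℂ) :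
    loopMass upperHalfPlaneSet (range γ) A = ⨆ t : ℝ≥0, loopMass upperHalfPlaneSet A (hull W t) := by
  rw [← loopMass_inter_dom isOpen_upperHalfPlaneSet (range γ) A, hγ.range_inter_eq_iUnion_hull hs,
    loopMass_def, hit_iUnion, iUnion_inter]
  have hmono : Monotone fun t : ℝ≥0 ↦ hit (hull W t) ∩ hit A := fun s t hst ↦
    inter_subset_inter_left _ (hit_mono (hull_mono W hst))
  rw [hmono.measure_iUnion]
  refine iSup_congr fun t ↦ ?_
  rw [loopMass_comm, loopMass_def]

/-! ### The almost-sure identity along SLE_κ, `0 < κ ≤ 4` -/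

/-- **[Lawler2009] §2.2, the loop-mass identity along the SLE_κ flow** (`0 < κ ≤ 4`, `A ∈ 𝒬*`):
almost surely, on `{γ[0,∞) ∩ A = ∅}`,
`Λ(γ[0,∞), A; ℍ) = 2 ∫₀^∞ starBubbleMass (A_t − W_t) dt`
(`= −(1/3) ∫₀^∞ SΦ_t(W_t) dt`, "the `a` would be replaced with `2`"), GIVEN the conformal
invariance of `Λ` (`hX`) and Lawler's Prop. 5.30 on Loewner hulls (`h530a`, `h530b`): a.s. the
trace is a simple generating curve (Rohde–Schramm), on the event all times are alive, the
deterministic identity `loopMass_hull_drvK_eq_lintegral` holds at every time, and both sides pass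
to `t = ∞` monotonically. [cite: Lawler2009, §2.2 (display before (4))] -/
theorem ae_loopMass_range_sleTrace_eq (hX : loopMass_conformalImage)
    (h530a : ∀ (U : ℕ → ℝ≥0 → ℝ) (u : ℕ → ℝ≥0), (∀ n, Continuous (U n)) → (∀ n, U n 0 = 0) →
      (∀ n, 0 < u n) → Tendsto u atTop (𝓝 0) →
      (∀ ε : ℝ, 0 < ε → ∀ᶠ n in atTop, hull (U n) (u n) ⊆ ball (0 : ℂ) ε) →
      ∀ {r : ℝ}, 0 < r →
        Tendsto (fun n ↦ (loopMass upperHalfPlaneSet (hull (U n) (u n)) {z : ℂ | r ≤ ‖z‖}).toReal /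
          (2 * (u n : ℝ))) atTop (𝓝 (1 / r ^ 2)))
    (h530b : ∀ (U : ℕ → ℝ≥0 → ℝ) (u : ℕ → ℝ≥0), (∀ n, Continuous (U n)) → (∀ n, U n 0 = 0) →
      (∀ n, 0 < u n) → Tendsto u atTop (𝓝 0) →
      (∀ ε : ℝ, 0 < ε → ∀ᶠ n in atTop, hull (U n) (u n) ⊆ ball (0 : ℂ) ε) →
      ∀ {B : Set ℂ}, IsStarHull B →
        Tendsto (fun n ↦ (loopMass upperHalfPlaneSet (hull (U n) (u n)) B).toReal / (2 * (u n : ℝ)))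
          atTop (𝓝 (starBubbleMass B)))
    {κ : ℝ≥0} (hκ0 : 0 < κ) (hκ4 : κ ≤ 4) {A : Set ℂ} (hA : IsStarHull A) :
    ∀ᵐ ω ∂preWienerMeasure, Disjoint (range (sleTrace κ ω)) A →
      loopMass upperHalfPlaneSet (range (sleTrace κ ω)) A =
        2 * ∫⁻ t, ENNReal.ofReal (starBubbleMass (slidHull (sleDriving κ ω) A t)) ∂timeMeasure := by
  rcases A.eq_empty_or_nonempty with rfl | hne
  · exact ae_of_all _ fun ω _ ↦ by simp [Loewner.slidHull_empty, starBubbleMass_empty]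
  obtain ⟨hgen, hsimple, -⟩ := sle_trace_facts_of_le_four hκ0 hκ4
  filter_upwards [ae_isGeneratedByCurve_sleTrace hgen, hsimple,
    ae_disjoint_closedHull_iff_lt_firstHit hκ0 hκ4 hA] with ω hg hs hiff hdisj
  have hT : firstHit (sleTrace κ ω) A = ⊤ := firstHit_eq_top_iff_disjoint.2 hdisj
  have hall : ∀ t, Disjoint (closedHull (drvK κ (brownianCPath ω)) t) A := fun t ↦
    (hiff t).2 (by rw [hT]; exact WithTop.coe_lt_top t)
  rw [lintegral_timeMeasure_eq_iSup_LpK hA hne hall, hg.loopMass_range_eq_iSup hs A, ENNReal.mul_iSup]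
  refine iSup_congr fun t ↦ ?_
  rw [← drvK_brownianCPath κ ω, loopMass_hull_drvK_eq_lintegral hX h530a h530b (brownianCPath ω) hA hne (hall t) le_rfl]
  rfl

end Literature.Probability.RandomPlanarGeometry

end
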